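import Literature.AlgebraicGeometry.Resolution.KummerPolynomialTools
import Literature.AlgebraicGeometry.Resolution.PthRootsOfOneUnits
import HarnessLib

/-!
# Kummer radicands `1 + P(y)`: elimination of the monomials of index divisible by `p` (Kuhlmann 2019, Lemma 4.3, proof: the polynomial `g̃`)

Topic: `Literature/AlgebraicGeometry/Resolution` (valued function fields). The first
transformation in the proof of F.-V. Kuhlmann, *Elimination of ramification II: Henselian
rationality*, Israel J. Math. 234 (2019) = arXiv:1701.05508, **Lemma 4.3** (mixed
characteristic normal form), p. 9 of the arXiv text:

> For every `i` divisible by `p`, we choose `d_i^{1/p}` to be any `p`-th root of `d_i` in `K`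
> … We choose a polynomial `s(y) ∈ K[y]` such that `s(y) ≡ (1 + ∑_{p|i} d_i^{1/p}y^{i/p})^{-1}
> mod p𝓜_K[y]` … We have that `s(y)^p ≡ (1 + ∑_{p|i} d_i^{1/p} y^{i/p})^{-p} mod p²𝓜_K[y]` and
> `s(y)^p(1+f(x)) = s(y)^p[(1+∑_{p|i}d_i^{1/p}y^{i/p})^p + f̃(y) + ∑_{p∤i} d_iy^i]` with
> `f̃(y) ∈ p𝓜_K[y]`. Modulo `p²𝓜_K[y]`, `s(y)^p(1+f(x))` is hence equivalent to
> `1 + s(y)^pf̃(y) + s(y)^p∑_{p∤i} d_iy^i`. In (4.13) we can replace `1+f` by `s(y)^p(1+f)`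
> without changing the right hand side. Since `vp² = 2vp ≥ (p/(p−1))vp` for all primes `p`,
> part a) of Lemma 3.1 shows that we can further replace `s(y)^p(1+f)` by `1 + g̃(y)` with
> (4.16) `g̃(y) := s(y)^pf̃(y) + s(y)^p∑_{p∤i} d_iy^i`. … [first case:] Let `d'_1` be the
> coefficient of `y` in `g̃(y)`. Since `s(y)^pf̃(y) ∈ p𝓜_K[y]` and the constant term of
> `s(y)^p` … is a `1`-unit, it follows that `v(d'_1 − d_1) > vd_1`, whence `vd'_1 = vd_1`, and
> that `d'_1y` is the unique summand of minimal value in `g̃(y)`. … [second case:] all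
> monomials in `g̃(y)` have value `> vp`.

This file PROVES this step as one theorem, `exists_radicand_without_pth_power_monomials`:
for `(F, V ∩ F)` henselian containing `K` (algebraically closed, of rank one) and `C`
(`C^{p−1} = −p`), `y ∈ F` with `v(y) ≤ 1`, and `P` over `K` with all coefficients of value
`< 1` (the `d_i`), there is `g̃` over `K` with all coefficients of value `< 1` and
`1 + P(y) ∈ (1 + g̃(y))·(F^×)^p`, such that (first case) if `v(d_1) ≥ v(p)`
[multiplicatively `v(p) ≤ v(d_1)`] and `v(d_i) < v(d_1)` for all `i ≥ 2` prime to `p`, then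
`g̃_1` has the value of `d_1` and strictly dominates every `g̃_m`, `m ≥ 2`; and (second case) if
`v(d_i) < v(p)` for all `i ≥ 1` prime to `p`, then all coefficients of `g̃` have value `< v(p)`.
(Lemma 3.1 a) = Kuhlmann 2010, Cor. 2.11 a), `exists_eq_mul_pow_of_valuation_lt`.)

## Sources

* [K19] F.-V. Kuhlmann, Israel J. Math. 234 (2019) = arXiv:1701.05508: Lemma 4.3 (proof,
  (4.16)). [Kuhlmann2019]
* [K10] F.-V. Kuhlmann, Trans. AMS 362 (2010) = arXiv:1003.5678: Cor. 2.11 a).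
  [Kuhlmann2010]

## Rendering notes

As in `PthRootsOfOneUnits.lean` and `KummerPolynomialTools.lean`: one valued field `(Ω, V)`,
subfields `K ≤ F ≤ Ω`, `p ≠ 0` in `Ω`, `v(p) < 1`, `C^{p−1} = −p`; polynomials over `Ω` with
coefficients in `K`; "`∈ p𝓜_K[y]`" = all coefficients of value `< v(p)`; "`a ∈ a'·(F^×)^p`" =
`∃ w ∈ F, w ≠ 0 ∧ a = a'·w^p`; values multiplicative. The printed `s(y)^p ≡ u^{-p} mod p²𝓜`
is replaced by the equivalent bound `v(((s u)^p − 1)_n) < v(C)^p` obtained from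
`s u ≡ 1` modulo coefficients of value `< v(Ct)`, `v(t) < 1`.
-/

noncomputable section

open IsLocalRing Polynomial Finset

namespace Literature.AlgebraicGeometry.Resolution

universe u

variable {Ω : Type u} [Field Ω] (V : ValuationSubring Ω)

/-- Coefficients of positive degree of a power: if `v(s_n) ≤ 1` for all `n` and `v(s_n) ≤ μ`
for `n ≥ 1`, then the same holds for every `s^m`. [folklore] -/
theorem valuation_coeff_pow_le_of_pos {s : Polynomial Ω} {μ : V.ValueGroup}
    (h1 : ∀ n, V.valuation (s.coeff n) ≤ 1) (hμs : ∀ n, 1 ≤ n → V.valuation (s.coeff n) ≤ μ)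
    (m n : ℕ) (hn : 1 ≤ n) : V.valuation ((s ^ m).coeff n) ≤ μ := by
  induction m generalizing n with
  | zero =>
    rw [pow_zero, coeff_one, if_neg (by omega), map_zero]; exact zero_le
  | succ m ih =>
    rw [pow_succ, coeff_mul]
    refine Valuation.map_sum_le _ fun x hx => ?_
    rw [mem_antidiagonal] at hx
    rw [map_mul]
    rcases Nat.eq_zero_or_pos x.2 with h0 | hpos
    · -- then `x.1 = n ≥ 1`
      have hx1 : 1 ≤ x.1 := by omega
      calc V.valuation ((s ^ m).coeff x.1) * V.valuation (s.coeff x.2) ≤ μ * 1 :=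
            mul_le_mul' (ih x.1 hx1) (h1 _)
        _ = μ := mul_one μ
    · calc V.valuation ((s ^ m).coeff x.1) * V.valuation (s.coeff x.2) ≤ 1 * μ :=
            mul_le_mul' (valuation_coeff_pow_le V h1 m x.1 |>.trans (by rw [one_pow])) (hμs _ hpos)
        _ = μ := one_mul μ

/-- The constant coefficient of a power is the power of the constant coefficient. [folklore] -/
theorem coeff_zero_pow' (s : Polynomial Ω) (m : ℕ) : (s ^ m).coeff 0 = s.coeff 0 ^ m := by
  rw [coeff_zero_eq_eval_zero, eval_pow, ← coeff_zero_eq_eval_zero]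

/-- A `1`-unit stays a `1`-unit under powers: `v(a − 1) < 1 ⇒ v(a^m − 1) < 1`. [folklore] -/
theorem valuation_pow_sub_one_lt {a : Ω} (ha : V.valuation (a - 1) < 1) (m : ℕ) :
    V.valuation (a ^ m - 1) < 1 := by
  have ha1 : V.valuation a ≤ 1 := by
    have : a = 1 + (a - 1) := by ring
    rw [this]; exact Valuation.map_add_le _ (le_of_eq (map_one _)) ha.le
  have hgeom : a ^ m - 1 = (a - 1) * ∑ i ∈ range m, a ^ i := by
    rw [mul_comm, geom_sum_mul]
  rw [hgeom, map_mul]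
  calc V.valuation (a - 1) * V.valuation (∑ i ∈ range m, a ^ i) ≤ V.valuation (a - 1) * 1 := by
        refine mul_le_mul' le_rfl (Valuation.map_sum_le _ fun i _ => ?_)
        rw [map_pow]; exact pow_le_one₀ zero_le ha1
    _ < 1 := by rw [mul_one]; exact ha

section Main

variable {p : ℕ} [hp : Fact p.Prime] {K F : Subfield Ω} (hK : IsAlgClosed K)
  (hr1 : IsRankOneValued V K) (hKF : K ≤ F) (hF : IsHenselianField F (V.comap (algebraMap F Ω)))
  {C : Ω} (hCK : C ∈ K) (hC : C ^ (p - 1) = -(p : Ω)) (hp0 : (p : Ω) ≠ 0)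
  (hvp : V.valuation (p : Ω) < 1)
include hK hr1 hKF hF hCK hC hp0 hvp

/-- **Kuhlmann 2019, Lemma 4.3 (proof): the radicand `1 + g̃(y)`** — statement in the module
docstring. PROVED following the printed computation: `p`-th roots `d_i^{1/p} ∈ K`
(`K` algebraically closed), `u = 1 + ∑_{p|i} d_i^{1/p}Y^{i/p}`,
`u^p = 1 + ∑_{p|i} d_iY^i + f̃` (`exists_one_add_sum_pow_eq_add`), the geometric inverse `s` of
`u` (`exists_geometric_inverse`, rank one), `s^p(1 + P) = (su)^p + g̃` with
`g̃ = s^p(∑_{p∤i} d_iY^i − f̃)` and `(su)^p − 1` of coefficients `< v(C)^p`, removed at `y` by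
Lemma 3.1 a) (`exists_eq_mul_pow_of_valuation_lt`). [cite: Kuhlmann2019, Lemma 4.3 (proof)] -/
theorem exists_radicand_without_pth_power_monomials {y : Ω} (hyF : y ∈ F)
    (hy : V.valuation y ≤ 1) {P : Polynomial Ω} (hPK : ∀ n, P.coeff n ∈ K)
    (hP : ∀ n, V.valuation (P.coeff n) < 1) :
    ∃ g : Polynomial Ω, (∀ n, g.coeff n ∈ K) ∧ (∀ n, V.valuation (g.coeff n) < 1) ∧
      (∃ w ∈ F, w ≠ 0 ∧ 1 + P.eval y = (1 + g.eval y) * w ^ p) ∧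
      (V.valuation (p : Ω) ≤ V.valuation (P.coeff 1) →
        (∀ i, 2 ≤ i → ¬ p ∣ i → V.valuation (P.coeff i) < V.valuation (P.coeff 1)) →
        V.valuation (g.coeff 1) = V.valuation (P.coeff 1) ∧
        ∀ m, 2 ≤ m → V.valuation (g.coeff m) < V.valuation (P.coeff 1)) ∧
      ((∀ i, 1 ≤ i → ¬ p ∣ i → V.valuation (P.coeff i) < V.valuation (p : Ω)) →
        ∀ m, V.valuation (g.coeff m) < V.valuation (p : Ω)) := by
  classical
  have hpr : p.Prime := hp.out
  have hvp0 : 0 < V.valuation (p : Ω) := (Valuation.pos_iff _).mpr hp0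
  have hC0 : C ≠ 0 := C_ne_zero hpr hC hp0
  have hvC1 : V.valuation C < 1 := valuation_C_lt_one V hC hvp
  have hvC0 : 0 < V.valuation C := (Valuation.pos_iff _).mpr hC0
  have hvCp : V.valuation C ^ p = V.valuation (p : Ω) * V.valuation C := valuation_C_pow V hpr hC
  have hpC : V.valuation (p : Ω) ≤ V.valuation C := valuation_p_le_valuation_C V hpr hC hvp
  set N := P.natDegree with hNdef
  set D : Finset ℕ := (range (N + 1)).filter (fun i => p ∣ i) with hD
  set D' : Finset ℕ := (range (N + 1)).filter (fun i => ¬ p ∣ i) with hD'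
  /- `p`-th roots of the `d_i`, `p ∣ i`, in `K` -/
  have hroot : ∀ i, ∃ r : Ω, r ∈ K ∧ r ^ p = P.coeff i := fun i => by
    obtain ⟨r, hr⟩ := IsAlgClosed.exists_pow_nat_eq (⟨P.coeff i, hPK i⟩ : K) hpr.pos
    exact ⟨r, r.2, by simpa using congrArg Subtype.val hr⟩
  choose ρ hρK hρ using hroot
  have hvρ : ∀ i, V.valuation (ρ i) < 1 := fun i => by
    have : V.valuation (ρ i) ^ p < 1 := by rw [← map_pow, hρ]; exact hP i
    exact lt_of_pow_lt_pow_left₀ p zero_le (by rwa [one_pow])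
  /- the polynomial `U = ∑_{p ∣ i} d_i^{1/p} Y^{i/p}` and the bound `t` on its coefficients -/
  set U : Polynomial Ω := ∑ i ∈ D, Polynomial.C (ρ i) * X ^ (i / p) with hU
  have hUK : ∀ n, U.coeff n ∈ K := forall_coeff_sum_mem D fun i _ => forall_coeff_C_mul_X_pow_mem (hρK i) _
  have hD0 : (0 : ℕ) ∈ D := by rw [hD, mem_filter]; exact ⟨mem_range.mpr (Nat.succ_pos N), dvd_zero p⟩
  obtain ⟨istar, histar, hmax⟩ := exists_max_image D (fun i => V.valuation (ρ i)) ⟨0, hD0⟩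
  obtain ⟨a, haK, ha1⟩ := hr1.1
  have ha0 : a ≠ 0 := fun h => by rw [h, map_zero] at ha1; exact not_lt_zero ha1
  have hainv : V.valuation a⁻¹ < 1 := by rw [map_inv₀]; exact inv_lt_one_of_one_lt₀ ha1
  obtain ⟨t, htK, ht0, ht1, hρt⟩ : ∃ t : Ω, t ∈ K ∧ t ≠ 0 ∧ V.valuation t < 1 ∧
      ∀ i ∈ D, V.valuation (ρ i) ≤ V.valuation t := by
    by_cases h0 : ρ istar = 0
    · refine ⟨a⁻¹, inv_mem haK, inv_ne_zero ha0, hainv, fun i hi => ?_⟩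
      have := hmax i hi
      rw [h0, map_zero] at this
      exact (le_antisymm this zero_le).symm ▸ zero_le
    · exact ⟨ρ istar, hρK istar, h0, hvρ istar, hmax⟩
  have hUt : ∀ n, V.valuation (U.coeff n) ≤ V.valuation t := by
    intro n
    rw [hU, finsetSum_coeff]
    -- at most one monomial contributes, but a crude bound suffices: distinct exponents
    have : ∀ i ∈ D, V.valuation ((Polynomial.C (ρ i) * X ^ (i / p)).coeff n) ≤
        if i / p = n then V.valuation t else 0 := fun i hi => by
      rw [coeff_C_mul_X_pow]
      by_cases h : n = i / p
      · rw [if_pos h, if_pos h.symm]; exact hρt i hi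
      · rw [if_neg h, if_neg (Ne.symm h), map_zero]
    -- the exponents `i / p`, `i ∈ D`, are pairwise distinct, so the sum has at most one
    -- non-zero term; we bound it by the ultrametric inequality instead
    exact Valuation.map_sum_le _ fun i hi => (this i hi).trans (by split_ifs <;> simp)
  /- the geometric inverse `s` of `u = 1 + U`, to precision `v(C t)` -/
  obtain ⟨s, hsK, hs1, hspos, hs0, hsu⟩ := exists_geometric_inverse V hr1 hUK htK ht0 ht1 hUt
    (mul_mem hCK htK) (mul_ne_zero hC0 ht0)
  set R : Polynomial Ω := s * (1 + U) - 1 with hR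
  have hRK : ∀ n, R.coeff n ∈ K :=
    forall_coeff_sub_mem (forall_coeff_mul_mem hsK (forall_coeff_add_mem forall_coeff_one_mem hUK))
      forall_coeff_one_mem
  have hvCt : V.valuation (C * t) < V.valuation C := by
    rw [map_mul]
    calc V.valuation C * V.valuation t < V.valuation C * 1 := mul_lt_mul_of_pos_left ht1 hvC0
      _ = V.valuation C := mul_one _
  have hRle : ∀ n, V.valuation (R.coeff n) ≤ V.valuation (C * t) := fun n => (hsu n).le
  /- `u^p = 1 + ∑_{p ∣ i} d_i Y^i + f̃` -/
  obtain ⟨Ft, hFtK, hFtv, hFteq⟩ := exists_one_add_sum_pow_eq_add V K hpr hp0 (D.image (· / p))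
    (e := fun k => ρ (k * p)) (fun k _ => hρK _) (fun k _ => hvρ _)
  have hinj : Set.InjOn (fun i : ℕ => i / p) D := by
    intro i hi j hj hij
    rw [hD, coe_filter] at hi hj
    simp only [Set.mem_setOf_eq] at hi hj hij
    rw [← Nat.div_mul_cancel hi.2, ← Nat.div_mul_cancel hj.2, hij]
  have hU' : ∑ k ∈ D.image (· / p), Polynomial.C (ρ (k * p)) * X ^ k = U := by
    rw [hU, sum_image hinj]
    refine sum_congr rfl fun i hi => ?_
    rw [hD, mem_filter] at hi
    rw [Nat.div_mul_cancel hi.2]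
  have hPD : ∑ k ∈ D.image (· / p), Polynomial.C (ρ (k * p) ^ p) * X ^ (k * p) = ∑ i ∈ D, Polynomial.C (P.coeff i) * X ^ i := by
    rw [sum_image hinj]
    refine sum_congr rfl fun i hi => ?_
    rw [hD, mem_filter] at hi
    rw [Nat.div_mul_cancel hi.2, hρ]
  rw [hU', hPD] at hFteq
  -- `P = ∑_{p ∣ i} d_i Y^i + P'`
  set P' : Polynomial Ω := ∑ i ∈ D', Polynomial.C (P.coeff i) * X ^ i with hP'
  have hP'K : ∀ n, P'.coeff n ∈ K := forall_coeff_sum_mem D' fun i _ => forall_coeff_C_mul_X_pow_mem (hPK i) _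
  have hPsplit : P = ∑ i ∈ D, Polynomial.C (P.coeff i) * X ^ i + P' := by
    conv_lhs => rw [P.as_sum_range_C_mul_X_pow]
    rw [hP', hD, hD', sum_filter_add_sum_filter_not]
  have hP'coeff : ∀ n, P'.coeff n = if ¬ p ∣ n ∧ n ≤ N then P.coeff n else 0 := by
    intro n
    rw [hP', finsetSum_coeff]
    simp only [coeff_C_mul_X_pow]
    rw [sum_ite_eq D' n (fun i => P.coeff i)]
    have hmem : n ∈ D' ↔ ¬ p ∣ n ∧ n ≤ N := by
      rw [hD', mem_filter, mem_range]
      constructor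
      · rintro ⟨h1, h2⟩; exact ⟨h2, by omega⟩
      · rintro ⟨h1, h2⟩; exact ⟨by omega, h1⟩
    by_cases h : ¬ p ∣ n ∧ n ≤ N
    · rw [if_pos (hmem.mpr h), if_pos h]
    · rw [if_neg (fun h' => h (hmem.mp h')), if_neg h]
  have hP'v : ∀ n, V.valuation (P'.coeff n) < 1 := fun n => by
    rw [hP'coeff]; split_ifs
    · exact hP n
    · rw [map_zero]; exact zero_lt_one
  /- `σ = s^p`, `g̃ = σ (P' - f̃)`, `E = (s u)^p - 1` -/
  set σ : Polynomial Ω := s ^ p with hσ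
  have hσK : ∀ n, σ.coeff n ∈ K := forall_coeff_pow_mem hsK p
  have hσ1 : ∀ n, V.valuation (σ.coeff n) ≤ 1 := fun n =>
    (valuation_coeff_pow_le V hs1 p n).trans (by rw [one_pow])
  have hσpos : ∀ n, 1 ≤ n → V.valuation (σ.coeff n) ≤ V.valuation t :=
    valuation_coeff_pow_le_of_pos V hs1 hspos p
  have hσ0 : V.valuation (σ.coeff 0 - 1) < 1 := by
    rw [hσ, coeff_zero_pow']
    exact valuation_pow_sub_one_lt V (hs0.trans_lt ht1) p
  have hσ0' : V.valuation (σ.coeff 0) = 1 := by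
    have : σ.coeff 0 = 1 + (σ.coeff 0 - 1) := by ring
    rw [this, Valuation.map_add_eq_of_lt_left _ (by rwa [map_one]), map_one]
  set g : Polynomial Ω := σ * (P' - Ft) with hg
  have hgK : ∀ n, g.coeff n ∈ K := forall_coeff_mul_mem hσK (forall_coeff_sub_mem hP'K hFtK)
  have hPFt : ∀ n, V.valuation ((P' - Ft).coeff n) < 1 :=
    valuation_coeff_sub_lt V hP'v fun n => (hFtv n).trans hvp
  have hgv : ∀ n, V.valuation (g.coeff n) < 1 := fun n => by
    have := valuation_coeff_mul_lt' V hσ1 hPFt zero_lt_one n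
    rwa [one_mul] at this
  set E : Polynomial Ω := (s * (1 + U)) ^ p - 1 with hE
  have hsu1 : s * (1 + U) = 1 + R := by rw [hR]; ring
  -- `E = R^p + p R S` with `S` of coefficients `≤ 1`
  set S : Polynomial Ω := ∑ k ∈ Ioo 0 p, (1 : Polynomial Ω) ^ (k - 1) * R ^ (p - k - 1) *
    ((p.choose k / p : ℕ) : Polynomial Ω) with hS
  have hEeq : E = R ^ p + (p : Polynomial Ω) * R * S := by
    rw [hE, hsu1, add_pow_prime_eq hpr (1 : Polynomial Ω) R, one_pow, mul_one]
    ring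
  have hS1 : ∀ n, V.valuation (S.coeff n) ≤ 1 := by
    refine valuation_coeff_sum_le V _ fun k _ n => ?_
    have hR1 : ∀ n, V.valuation (R.coeff n) ≤ 1 := fun n => (hRle n).trans (hvCt.le.trans hvC1.le)
    have h1 : ∀ n, V.valuation (((1 : Polynomial Ω) ^ (k - 1) * R ^ (p - k - 1)).coeff n) ≤ 1 := fun n => by
      rw [one_pow, one_mul]
      exact (valuation_coeff_pow_le V hR1 _ n).trans (by rw [one_pow])
    have h2 : ∀ n, V.valuation (((p.choose k / p : ℕ) : Polynomial Ω).coeff n) ≤ 1 := fun n => by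
      rw [← C_eq_natCast, coeff_C]; split_ifs
      · exact valuation_natCast_le_one V _
      · rw [map_zero]; exact zero_le
    simpa using valuation_coeff_mul_le V h1 h2 n
  have hEv : ∀ n, V.valuation (E.coeff n) < V.valuation C ^ p := by
    intro n
    rw [hEeq]
    refine valuation_coeff_add_lt V (fun n => ?_) (fun n => ?_) n
    · -- `R^p`
      calc V.valuation ((R ^ p).coeff n) ≤ V.valuation (C * t) ^ p := valuation_coeff_pow_le V hRle p n
        _ < V.valuation C ^ p := pow_lt_pow_left₀ hvCt zero_le hpr.ne_zero
    · -- `p R S`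
      have hpR : ∀ n, V.valuation (((p : Polynomial Ω) * R).coeff n) ≤ V.valuation (p : Ω) * V.valuation (C * t) :=
        fun n => by rw [← C_eq_natCast]; exact valuation_coeff_C_mul_le V hRle _ n
      calc V.valuation (((p : Polynomial Ω) * R * S).coeff n)
          ≤ V.valuation (p : Ω) * V.valuation (C * t) * 1 := valuation_coeff_mul_le V hpR hS1 n
        _ < V.valuation (p : Ω) * V.valuation C := by
            rw [mul_one]; exact mul_lt_mul_of_pos_left hvCt hvp0
        _ = V.valuation C ^ p := hvCp.symm
  have hEK : ∀ n, E.coeff n ∈ K := forall_coeff_sub_mem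
    (forall_coeff_pow_mem (forall_coeff_mul_mem hsK (forall_coeff_add_mem forall_coeff_one_mem hUK)) p)
    forall_coeff_one_mem
  /- the polynomial identity `σ (1 + P) = 1 + g + E` -/
  have hident : σ * (1 + P) = 1 + g + E := by
    have h1 : (1 : Polynomial Ω) + P = (1 + U) ^ p - Ft + P' := by
      rw [hPsplit, hFteq]; ring
    rw [h1, hg, hE, hσ, mul_pow]
    ring
  /- evaluation at `y` -/
  have hyV : y ∈ V := (V.valuation_le_one_iff y).mp hy
  have hgyF : g.eval y ∈ F := eval_mem_subfield_of_coeff_mem (fun k => hKF (hgK k)) hyF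
  have hEyF : E.eval y ∈ F := eval_mem_subfield_of_coeff_mem (fun k => hKF (hEK k)) hyF
  have hsyF : s.eval y ∈ F := eval_mem_subfield_of_coeff_mem (fun k => hKF (hsK k)) hyF
  have hgy : V.valuation (g.eval y) < 1 := valuation_eval_lt_of_coeff_lt V hgv hy
  have hEy : V.valuation (E.eval y) < V.valuation C ^ p := valuation_eval_lt_of_coeff_lt V hEv hy
  have hRy : V.valuation (R.eval y) < 1 :=
    (valuation_eval_le_of_coeff_le V hRle hy).trans_lt (hvCt.trans hvC1)
  have hsy0 : s.eval y ≠ 0 := by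
    intro h0
    have h1 : (s * (1 + U)).eval y = 1 + R.eval y := by rw [hsu1, eval_add, eval_one]
    rw [eval_mul, h0, zero_mul] at h1
    have : V.valuation (1 + R.eval y) = 1 := by
      rw [Valuation.map_add_eq_of_lt_left _ (by rwa [map_one]), map_one]
    rw [← h1, map_zero] at this
    exact zero_ne_one this
  -- Lemma 3.1 a): drop `E(y)`
  obtain ⟨w, hwF, hw0, hw⟩ := exists_eq_mul_pow_of_valuation_lt V hF hpr (hKF hCK) hC hp0 hvp
    hgyF hEyF hgy hEy
  have heval : s.eval y ^ p * (1 + P.eval y) = 1 + g.eval y + E.eval y := by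
    have := congrArg (eval y) hident
    simpa only [eval_mul, eval_add, eval_one, eval_pow, hσ] using this
  refine ⟨g, hgK, hgv, ⟨w / s.eval y, div_mem hwF hsyF, div_ne_zero hw0 hsy0, ?_⟩, ?_, ?_⟩
  · -- `1 + P(y) = (1 + g(y)) (w / s(y))^p`
    have hsp : s.eval y ^ p ≠ 0 := pow_ne_zero _ hsy0
    rw [div_pow, ← mul_div_assoc, ← hw, ← heval, mul_comm, mul_div_assoc, div_self hsp, mul_one]
  · /- first case -/
    intro h1 hdom
    have hP10 : P.coeff 1 ≠ 0 := fun h0 => by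
      rw [h0, map_zero] at h1; exact not_lt.mpr h1 hvp0
    have hvP1 : 0 < V.valuation (P.coeff 1) := (Valuation.pos_iff _).mpr hP10
    have hp1 : ¬ p ∣ 1 := fun h => hpr.ne_one (Nat.dvd_one.mp h)
    have hN1 : 1 ≤ N := by
      by_contra hlt
      push Not at hlt
      have : P.coeff 1 = 0 := coeff_eq_zero_of_natDegree_lt (by omega)
      exact hP10 this
    -- the coefficient formula for `g = σ P' - σ Ft`
    have hgcoeff : ∀ m, g.coeff m = ∑ x ∈ antidiagonal m, σ.coeff x.1 * P'.coeff x.2 - (σ * Ft).coeff m := by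
      intro m; rw [hg, mul_sub, coeff_sub, coeff_mul]
    have hσFt : ∀ m, V.valuation ((σ * Ft).coeff m) < V.valuation (p : Ω) := fun m => by
      have := valuation_coeff_mul_lt' V hσ1 hFtv zero_lt_one m
      rwa [one_mul] at this
    -- value of a general term `σ_{m-i} P'_i`
    have hterm : ∀ m i, i ≤ m → 2 ≤ i → V.valuation (σ.coeff (m - i) * P'.coeff i) < V.valuation (P.coeff 1) := by
      intro m i _ hi
      rw [map_mul, hP'coeff]
      split_ifs with h
      · calc V.valuation (σ.coeff (m - i)) * V.valuation (P.coeff i) ≤ 1 * V.valuation (P.coeff i) :=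
              mul_le_mul' (hσ1 _) le_rfl
          _ < V.valuation (P.coeff 1) := by rw [one_mul]; exact hdom i hi h.1
      · rw [map_zero, mul_zero]; exact hvP1
    have hterm0 : ∀ m, V.valuation (σ.coeff m * P'.coeff 0) = 0 := fun m => by
      rw [hP'coeff, if_neg (fun h => h.1 (dvd_zero p)), mul_zero, map_zero]
    refine ⟨?_, ?_⟩
    · -- `m = 1`: `g_1 = σ_0 d_1 + σ_1 P'_0 - (σ Ft)_1`
      rw [hg, mul_sub, coeff_sub, mul_coeff_one]
      have hmain : V.valuation (σ.coeff 0 * P'.coeff 1) = V.valuation (P.coeff 1) := by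
        rw [map_mul, hσ0', one_mul, hP'coeff, if_pos ⟨hp1, hN1⟩]
      have hsmall : V.valuation (σ.coeff 1 * P'.coeff 0 - (σ * Ft).coeff 1) < V.valuation (P.coeff 1) := by
        refine Valuation.map_sub_lt _ ?_ ((hσFt 1).trans_le h1)
        rw [hterm0]; exact hvP1
      rw [← hmain] at hsmall ⊢
      rw [add_sub_assoc]
      exact Valuation.map_add_eq_of_lt_left _ hsmall
    · intro m hm
      rw [hgcoeff m]
      refine Valuation.map_sub_lt _ ?_ ((hσFt m).trans_le h1)
      refine Valuation.map_sum_lt _ hvP1.ne' fun x hx => ?_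
      rw [mem_antidiagonal] at hx
      rcases Nat.lt_or_ge x.2 2 with hlt | hge
      · interval_cases h : x.2
        · rw [hterm0]; exact hvP1
        · -- `σ_{m-1} d_1` with `m - 1 ≥ 1`
          rw [map_mul, hP'coeff, if_pos ⟨hp1, hN1⟩]
          calc V.valuation (σ.coeff x.1) * V.valuation (P.coeff 1)
              ≤ V.valuation t * V.valuation (P.coeff 1) := mul_le_mul' (hσpos x.1 (by omega)) le_rfl
            _ < 1 * V.valuation (P.coeff 1) := mul_lt_mul_of_pos_right ht1 hvP1
            _ = V.valuation (P.coeff 1) := one_mul _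
      · have := hterm m x.2 (by omega) hge
        rwa [show m - x.2 = x.1 by omega] at this
  · /- second case -/
    intro h2 m
    have hgcoeff : g.coeff m = ∑ x ∈ antidiagonal m, σ.coeff x.1 * P'.coeff x.2 - (σ * Ft).coeff m := by
      rw [hg, mul_sub, coeff_sub, coeff_mul]
    have hσFt : V.valuation ((σ * Ft).coeff m) < V.valuation (p : Ω) := by
      have := valuation_coeff_mul_lt' V hσ1 hFtv zero_lt_one m
      rwa [one_mul] at this
    rw [hgcoeff]
    refine Valuation.map_sub_lt _ (Valuation.map_sum_lt _ hvp0.ne' fun x _ => ?_) hσFt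
    rw [map_mul, hP'coeff]
    split_ifs with h
    · have hx2 : 1 ≤ x.2 := Nat.one_le_iff_ne_zero.mpr fun h0 => h.1 (h0 ▸ dvd_zero p)
      calc V.valuation (σ.coeff x.1) * V.valuation (P.coeff x.2) ≤ 1 * V.valuation (P.coeff x.2) :=
            mul_le_mul' (hσ1 _) le_rfl
        _ < V.valuation (p : Ω) := by rw [one_mul]; exact h2 x.2 hx2 h.1
    · rw [map_zero, mul_zero]; exact hvp0

end Main

end Literature.AlgebraicGeometry.Resolution

end
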